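import Literature.MathematicalPhysics.QuantumFieldTheory.BalabanImbrieJaffe1984to88.BIJ88ConnectedGraphFillingVsupp
import Literature.MathematicalPhysics.QuantumFieldTheory.BalabanImbrieJaffe1984to88.BIJ88Eq5145CornerModulus
import Literature.MathematicalPhysics.QuantumFieldTheory.BalabanImbrieJaffe1984to88.BIJ88EffectiveActionL1Remainder308

/-!
# `BalabanImbrieJaffe1984to88.BIJ88W6PrimeVsupp` — T. Bałaban, J. Imbrie, A. Jaffe, *Effective action and cluster properties of the abelian Higgs
model*, Commun. Math. Phys. **114** (1988) 257–315 [BalabanImbrieJaffe1988], Sect. 5.14, p. 310 [PDF 54], DISPLAY 4 **`ℛ_k(Λ^{(k)}_{12}) =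
Σ_{X⊂Λ^{(k)}_{12}} W₆^{(k)′}(X)`** with **`W₆^{(k)′}` AS PRINTED** — *"Here W₆^{(k)′}(X) is obtained by summing only over {X_γ}, (Y₁, …, Y_B) which fill X,
summing over {γ_j} with suppt(d/dt)_{γ_j} ⊂ X, and integrating over t as in (5.14.2)"* — ON THE §5.13 GAUSSIAN MODEL IN THE BOOKKEEPING OF RECORD
(the cluster-configuration gas of (5.14.3) on the virtual supports of p25's `BIJ88Expansion5143Ordered`, located slot data of p25's
`BIJ88Eq5145CornerModel`/`CornerUrsell` — the currency of the head theorem of row C2.Eq5.14.5, whose exponent carries `ℛ_k(Λ₁₂) :=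
(n̄+1)·remR(t ↦ Σ_γ T_{γ,t})` with display 4 read as a definition).

statement-level skeleton of published theorems with citation tags; proofs where landed; nothing here is a claim about the Yang–Mills mass gap

PDF held: `paper:balaban1988-cmp114-bij-abelian-higgs-effective-action` (journal page = PDF page + 256); pp. 308–310 = PDF 52–54 read this generation
(`p0054.txt` L20–25: display 4 and the defining sentence).

WHAT IS REPRODUCED (unit `lit-balaban-p36`, generation 13 of the Phase-2 proof seat p36, file 5 of the display-4 chain; SKELETON rows
**C2.Claim@310** (display 4 / the definition of `W₆′`, member), **C2.Eq5.14.1-5.14.2** ((5.14.2) remainder, member), **C2.Eq5.14.5** (member) of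
`HOME/lit-balaban-r16/ROWS-C2-part2.md`; owner r16, heads untouched; HOME `run/shared/lean/pub/lit-balaban/`).  Setting: sites `α` in cubes `blk`,
coupling `Δ ≻ 0` abutting cubes only, source `ℱ`, corner `Λ`; the region `X` carries p25's law `regionLaw blk Δ ℱ X Λ` and located slots
`↥(slotB X) ⊕ ↥(slotY X)`; labels `L`, `|L| = n̄+1`.
* §1 LOCATED DATA OF NESTED REGIONS: `inclSlot` (a slot located in `X ⊆ W₀` as a slot of `W₀`), `cubeIn_inclSlot`, `fD_inclSlot` (the p. 308 cube
  factors of `W₀`'s data along `incl ∘ γ` and of `X`'s data along `γ` agree on the cubes of `X`), **`actIn_inclSlot`** (so do the prime-dropped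
  activities on the polymers of `X`: `g1_congr`, `expect_congr`), `sum_filter_supp_eq_sum_incl` (the assignments of `W₀` supported in `X` ARE the
  assignments of `X`).
* §2 **`W6v`** — `W₆^{(k)′}(X)` AS PRINTED (definition with body): `(n̄+1)·remR(t ↦ Σ_{γ : supp γ ⊆ X} T^{fill X}_{γ,t}(L))`, the `X`-pieces
  (`BIJ88ConnectedGraphFilling.TsumFill`) of the display-3 truncated functions of the `W₀`-gas summed over the assignments supported in `X` and
  integrated *"as in (5.14.2)"* (r16's `remR` times `(n̄+1)`, restoring the printed `1/n̄!` — slip GAPS G-C2-p36-06, as in the head theorem's `ℛ_k`).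
* §3 THE CLOSED FORM: `integrand_eq_cornerSum` (for `t ∈ (0,1]`, modulo (5.14.4): the integrand of `W₆′(X)` is the corner sum over `X' ⊆ X` of
  `D_{X'}(t) := Σ_{γ'} T[X'-gas]_{γ',t}(L)` — `BIJ88ConnectedGraphFillingVsupp.TsumFill_vsupp_eq_cornerSum_of_ineq5144` + §1),
  **`DIn_eq_iteratedDeriv_log_ztIn`** (`D_X(t) = (d/dt)^{n̄+1} log z_t(X)`, p36 g11 `sum_Tsum_univ_eq_iteratedDeriv_log_zG_of_ineq5144` on the located
  data), `intervalIntegrable_weight_DIn` (p36 g12 `integrableOn_remainderDensity_of_L1` + p36 g13 `slotFields_L1_mod_regionLaw`),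
  **`W6v_eq_cornerSum`**: `W₆′(X) = Σ_{X'⊆X} (−1)^{|X∖X'|} ℛ(X')` — `W₆′` IS THE MÖBIUS INVERSE (connected part in the region variable) OF THE
  SUB-REGION REMAINDERS `ℛ(X') := (n̄+1)·remR(D_{X'})`.
* §4 **`display4`**: `Σ_{X ⊆ W₀} W₆′(X) = ℛ(W₀)` = `(n̄+1)·remR(t ↦ Σ_γ T[W₀-gas]_{γ,t}(L))` — THE EXPONENT TERM OF THE (5.14.5) HEAD THEOREM
  (`BIJ88Eq5145CornerModulus.eq5145_zG_mod_remR_of_ineq5144`), i.e. display 4 DERIVED, not read as a definition.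
RELATION TO p25: `BIJ88RemainderW6Prime.W6'` / `BIJ88RemainderW6Tsum.remR_Tsum_eq_sum_W6'` (p25 g5/g12) are `W₆′` and display 4 for p25's
SCHEMATIC model (polymers `polys R Λ`, abstract activities `g₃ t γ`, the `t`-integrability `hint` displayed); this file is the same sentence for the
bookkeeping of record (p25's cluster-configuration gas `polysOf`/`cvsupp`, the located Gaussian data of `BIJ88Eq5145CornerModel`), with the
integrability DISCHARGED (`intervalIntegrable_weight_DIn`) and the region sum identified with the head theorem's `ℛ_k` on the nose.
HYPOTHESES (all explicit, = those of the head theorem, plus): the leaf (5.14.4) for the located data OF EVERY SUB-REGION `X ⊆ W₀` at every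
`t ∈ (0,1]` (`h5144`; the sub-region gases enter through the Möbius form), linear-or-modulus slot fields `hmod` (for the one-sided `t = 0` behaviour
of the sub-region remainders, p. 309).  HONEST SCOPE: (a) (5.14.4) NOT proved (typed leaf `Ineq5144`); (b) the bound `IneqW6′` for this `W₆′` is the
sibling `BIJ88W6PrimeVsuppBound`; (c) `(n̄+1)!` slip G-C2-p36-06; (d) gen 5's KP-type regime constants.  1 definition with body (`W6v`) + 1 plumbing
`def` (`inclSlot`) + 3 notational `abbrev`s (`actIn`/`TIn`/`DIn`: the located activities, truncated functions and their assignment sum `D_X`),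
0 `Prop` facts, 0 `sorry`; imports `BIJ88ConnectedGraphFillingVsupp`, `BIJ88Eq5145CornerModulus` (p36 g13), `BIJ88EffectiveActionL1Remainder308`
(p36 g12); modifies nothing.  NOT summit progress; NOT continuum; NOT Clay.  Cell `lit-balaban` Phase 2, seat p36 gen 13 (row owner r16, referee ref-5).
-/

noncomputable section

open Finset MeasureTheory ProbabilityTheory Filter
open scoped Topology
open Literature.MathematicalPhysics.QuantumFieldTheory.BalabanImbrieJaffe1984to88.BIJ88DirichletForms305 (interpForm)
open Literature.MathematicalPhysics.QuantumFieldTheory.BalabanImbrieJaffe1984to88.BIJ88PolymerRep5134 (g1 corner)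
open Literature.MathematicalPhysics.QuantumFieldTheory.BalabanImbrieJaffe1984to88.BIJ88PolymerRep5134Gauss (ext prec expect zG)
open Literature.MathematicalPhysics.QuantumFieldTheory.BalabanImbrieJaffe1984to88.BIJ88Eq5134TwoSpecies (g1_congr)
open Literature.MathematicalPhysics.QuantumFieldTheory.BalabanImbrieJaffe1984to88.BIJ88Expansion5143 (g3 prime)
open Literature.MathematicalPhysics.QuantumFieldTheory.BalabanImbrieJaffe1984to88.BIJ88Expansion5143Gauss (fD expect_congr)
open Literature.MathematicalPhysics.QuantumFieldTheory.BalabanImbrieJaffe1984to88.BIJ88Expansion5143Ordered (polysOf cvsupp locv wv cubesOf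
  cubesOf_vsupp wv_vsupp)
open Literature.MathematicalPhysics.QuantumFieldTheory.BalabanImbrieJaffe1984to88.BIJ88Expansion5143Obs (mem_polysOf)
open Literature.MathematicalPhysics.QuantumFieldTheory.BalabanImbrieJaffe1984to88.BIJ88ConnectedGraphResummation (OWP InQ Cov wprod Traw Tord Tsum)
open Literature.MathematicalPhysics.QuantumFieldTheory.BalabanImbrieJaffe1984to88.BIJ88ConnectedGraphFilling (TsumFill TordFill cornerSum_congr
  cornerSum_finset_sum Tsum_image_congr)
open Literature.MathematicalPhysics.QuantumFieldTheory.BalabanImbrieJaffe1984to88.BIJ88VirtualSupports310 (vsupp_injective)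
open Literature.MathematicalPhysics.QuantumFieldTheory.BalabanImbrieJaffe1984to88.BIJ88ConnectedGraphFillingVsupp
  (TsumFill_vsupp_eq_cornerSum_of_ineq5144 Tsum_vsupp_eq_zero_of_not_mem TsumFill_vsupp_eq_zero_of_not_mem)
open Literature.MathematicalPhysics.QuantumFieldTheory.BalabanImbrieJaffe1984to88.BIJ88Clusters5134 (cornerSum sum_powerset_cornerSum)
open Literature.MathematicalPhysics.QuantumFieldTheory.BalabanImbrieJaffe1984to88.BIJ88SlotMoments308 (zt zt_eq slotFactor)
open Literature.MathematicalPhysics.QuantumFieldTheory.BalabanImbrieJaffe1984to88.BIJ88SlotMomentsGauss308 (uD continuous_ext measurable_ext)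
open Literature.MathematicalPhysics.QuantumFieldTheory.BalabanImbrieJaffe1984to88.BIJ88SlotConnectedGraph310KP
  (sum_Tsum_univ_eq_iteratedDeriv_log_zG_of_ineq5144)
open Literature.MathematicalPhysics.QuantumFieldTheory.BalabanImbrieJaffe1984to88.BIJ88EffectiveActionGauss308 (remR_congr_Ioc)
open Literature.MathematicalPhysics.QuantumFieldTheory.BalabanImbrieJaffe1984to88.BIJ88EffectiveActionL1Remainder308
  (integrableOn_remainderDensity_of_L1)
open Literature.MathematicalPhysics.QuantumFieldTheory.BalabanImbrieJaffe1984to88.BIJ88GaussShellModulus309 (continuous_and_zero_of_mod)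
open Literature.MathematicalPhysics.QuantumFieldTheory.BalabanImbrieJaffe1984to88.BIJ88Eq5145CornerModulus (slotFields_L1_mod_regionLaw)
open Literature.MathematicalPhysics.QuantumFieldTheory.BalabanImbrieJaffe1984to88.BIJ88Ineq5113Covering (cubeSys)
open Literature.MathematicalPhysics.QuantumFieldTheory.BalabanImbrieJaffe1984to88.BIJ88Sect2Statements (pLog)
open Literature.MathematicalPhysics.QuantumFieldTheory.BalabanImbrieJaffe1984to88.BIJ88Sect5Statements (CutoffProfile cutoff)
open Literature.MathematicalPhysics.QuantumFieldTheory.BalabanImbrieJaffe1984to88.BIJ88Sect5StatementsPart2 (Ineq5144)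
open Literature.MathematicalPhysics.QuantumFieldTheory.BalabanImbrieJaffe1984to88.BIJ88Sect5StatementsPart4 (remR)
open Literature.MathematicalPhysics.QuantumFieldTheory.BalabanImbrieJaffe1984to88.BIJ88Eq5145CornerModel
open Literature.MathematicalPhysics.QuantumFieldTheory.BalabanImbrieJaffe1984to88.BIJ88Eq5145CornerUrsell (cubeIn cubeIn_mem interpForm_abutting
  ztIn_eq_zG_located)

namespace Literature.MathematicalPhysics.QuantumFieldTheory.BalabanImbrieJaffe1984to88.BIJ88W6PrimeVsupp

variable {α I : Type} [Fintype α] [DecidableEq α] [Fintype I] [DecidableEq I]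
  (blk : α → I) (Δ : Matrix α α ℝ) (ℱ : α → ℝ)
variable (adj : I → I → Prop) [DecidableRel adj]
variable (χ : CutoffProfile) {ι υ : Type*} [DecidableEq ι] [DecidableEq υ]
variable {p ek : ℝ} {B : Finset ι} {Φ : ι → (α → ℝ) → ℝ} {c : ι → ℝ} {Ys : Finset υ} {V : υ → (α → ℝ) → ℝ}
variable (cube : ↥B ⊕ ↥Ys → I) (Λ : Finset I)

/-! ## §1 Located data of nested regions -/

section Incl

variable {cube} {X W₀ : Finset I}

/-- **a slot located in `X ⊆ W₀` as a slot located in `W₀`** (the χ-slots and interaction slots of p. 308 whose cube lies in `X`, p25's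
`slotB`/`slotY`). [cite: BalabanImbrieJaffe1988, (5.14.2) p.308] -/
def inclSlot (h : X ⊆ W₀) : ↥(slotB B Ys cube X) ⊕ ↥(slotY B Ys cube X) → ↥(slotB B Ys cube W₀) ⊕ ↥(slotY B Ys cube W₀)
  | Sum.inl b => Sum.inl ⟨b.1, (mem_slotB B Ys cube W₀ b.1).2 (h ((mem_slotB B Ys cube X b.1).1 b.2))⟩
  | Sum.inr Y => Sum.inr ⟨Y.1, (mem_slotY B Ys cube W₀ Y.1).2 (h ((mem_slotY B Ys cube X Y.1).1 Y.2))⟩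

omit [Fintype I] [DecidableEq ι] [DecidableEq υ] in
/-- the inclusion preserves the cube. [cite: BalabanImbrieJaffe1988, (5.14.2) p.308] -/
@[simp] theorem cubeIn_inclSlot (h : X ⊆ W₀) (τ : ↥(slotB B Ys cube X) ⊕ ↥(slotY B Ys cube X)) :
    cubeIn cube W₀ (inclSlot h τ) = cubeIn cube X τ := by
  rcases τ with b | Y <;> rfl

omit [Fintype I] [DecidableEq ι] [DecidableEq υ] in
/-- the inclusion is injective. [cite: BalabanImbrieJaffe1988, (5.14.2) p.308] -/
theorem inclSlot_injective (h : X ⊆ W₀) : Function.Injective (inclSlot (B := B) (Ys := Ys) (cube := cube) h) := by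
  rintro (b | Y) (b' | Y') hh
  · simp only [inclSlot, Sum.inl.injEq, Subtype.mk.injEq] at hh
    rw [Subtype.ext hh]
  · simp [inclSlot] at hh
  · simp [inclSlot] at hh
  · simp only [inclSlot, Sum.inr.injEq, Subtype.mk.injEq] at hh
    rw [Subtype.ext hh]

omit [Fintype I] [DecidableEq ι] [DecidableEq υ] in
/-- every slot of `W₀` whose cube lies in `X` is the inclusion of a slot of `X`. [cite: BalabanImbrieJaffe1988, (5.14.2) p.308] -/
theorem exists_inclSlot_eq (h : X ⊆ W₀) (τ : ↥(slotB B Ys cube W₀) ⊕ ↥(slotY B Ys cube W₀)) (hτ : cubeIn cube W₀ τ ∈ X) :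
    ∃ τ' : ↥(slotB B Ys cube X) ⊕ ↥(slotY B Ys cube X), inclSlot h τ' = τ := by
  rcases τ with b | Y
  · exact ⟨Sum.inl ⟨b.1, (mem_slotB B Ys cube X b.1).2 hτ⟩, rfl⟩
  · exact ⟨Sum.inr ⟨Y.1, (mem_slotY B Ys cube X Y.1).2 hτ⟩, rfl⟩

omit [Fintype α] [DecidableEq α] [Fintype I] [DecidableEq ι] [DecidableEq υ] in
/-- **the located derivative factors of `W₀` and of `X ⊆ W₀` agree slot by slot**: the `m`-th `t`-derivative of the slot factor of `incl τ` in the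
data of `W₀` is that of `τ` in the data of `X` (both are `χ(c_b p(te_k), Φ_b)` resp. `e^{−tV_Y}` of the same global slot).
[cite: BalabanImbrieJaffe1988, (5.14.2) p.308] -/
theorem uD_inclSlot (h : X ⊆ W₀) (t : ℝ) (τ : ↥(slotB B Ys cube X) ⊕ ↥(slotY B Ys cube X)) (m : ℕ) (φ : α → ℝ) :
    uD χ p ek (slotB B Ys cube W₀) (fun b : ↥B => Φ b) (fun b : ↥B => c b) (slotY B Ys cube W₀) (fun Y : ↥Ys => V Y) t (inclSlot h τ) m φ =
      uD χ p ek (slotB B Ys cube X) (fun b : ↥B => Φ b) (fun b : ↥B => c b) (slotY B Ys cube X) (fun Y : ↥Ys => V Y) t τ m φ := by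
  rcases τ with b | Y <;> rfl

omit [Fintype α] [DecidableEq α] [Fintype I] in
/-- **the p. 308 cube factors of the two located data agree on the cubes of `X`**: for `i ∈ X`, the derivative observable of cube `i` built from
the data of `W₀` along `incl ∘ γ` equals the one built from the data of `X` along `γ` (the slots at cube `i` correspond under `incl`, the factors
and multiplicities agree). [cite: BalabanImbrieJaffe1988, (5.14.3) p.309] -/
theorem fD_inclSlot (h : X ⊆ W₀) {L : Type*} [DecidableEq L] (γ : L → ↥(slotB B Ys cube X) ⊕ ↥(slotY B Ys cube X)) (t : ℝ)
    (H : Finset L) {i : I} (hi : i ∈ X) :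
    fD (uD χ p ek (slotB B Ys cube W₀) (fun b : ↥B => Φ b) (fun b : ↥B => c b) (slotY B Ys cube W₀) (fun Y : ↥Ys => V Y) t)
        (cubeIn cube W₀) (inclSlot h ∘ γ) H i =
      fD (uD χ p ek (slotB B Ys cube X) (fun b : ↥B => Φ b) (fun b : ↥B => c b) (slotY B Ys cube X) (fun Y : ↥Ys => V Y) t)
        (cubeIn cube X) γ H i := by
  funext φ
  unfold fD
  symm
  refine Finset.prod_nbij (inclSlot h) (fun τ hτ => ?_) (fun τ _ τ' _ hh => inclSlot_injective h hh) (fun τ hτ => ?_) (fun τ _ => ?_)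
  · rw [mem_filter] at hτ ⊢
    exact ⟨mem_univ _, by rw [cubeIn_inclSlot]; exact hτ.2⟩
  · obtain ⟨-, hτi⟩ := mem_filter.1 (mem_coe.1 hτ)
    obtain ⟨τ', rfl⟩ := exists_inclSlot_eq h τ (hτi ▸ hi)
    exact ⟨τ', mem_coe.2 (mem_filter.2 ⟨mem_univ _, by rwa [cubeIn_inclSlot] at hτi⟩), rfl⟩
  · have hm : (H.filter fun j => (inclSlot h ∘ γ) j = inclSlot h τ) = H.filter fun j => γ j = τ := by
      ext j
      simp only [mem_filter, Function.comp_apply]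
      exact ⟨fun ⟨hj, hγ⟩ => ⟨hj, inclSlot_injective h hγ⟩, fun ⟨hj, hγ⟩ => ⟨hj, by rw [hγ]⟩⟩
    rw [uD_inclSlot, hm]

end Incl

section Notation

variable (p ek B Φ c Ys V)

/-- **the prime-dropped activities of the located data of the region `X` at the corner `Λ`, time `t`, assignment `γ`** (p. 309: `g₃(H_β, X_β)`
with the prime dropped, for the Gaussian measures of §5.13: p25's `prime (g3 adj ·)` of the corner expectations `zG` of the p. 308 derivative
observables `fD (uD … t) (cubeIn X) γ`, form `Δ_{1_Λ}`) — notation for the activity appearing in the head theorem of row C2.Eq5.14.5.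
[cite: BalabanImbrieJaffe1988, (5.14.3)–(5.14.4) p.309] -/
abbrev actIn (X : Finset I) (t : ℝ) {L : Type*} [DecidableEq L] (γ : L → ↥(slotB B Ys cube X) ⊕ ↥(slotY B Ys cube X)) :
    Finset L → Finset I → ℝ :=
  prime (g3 adj fun H' => zG blk (interpForm blk Δ (corner ℝ Λ)) ℱ
    (fD (uD χ p ek (slotB B Ys cube X) (fun b : ↥B => Φ b) (fun b : ↥B => c b) (slotY B Ys cube X) (fun Y : ↥Ys => V Y) t)
      (cubeIn cube X) γ H'))

/-- **the truncated function of the `X`-gas** (display 3 on the cluster-configuration gas of the region `X` with its located data): notation.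
[cite: BalabanImbrieJaffe1988, p.310 (Sect. 5.14)] -/
abbrev TIn (X : Finset I) (t : ℝ) {L : Type*} [Fintype L] [DecidableEq L] (γ : L → ↥(slotB B Ys cube X) ⊕ ↥(slotY B Ys cube X))
    (K : Finset L) : ℝ :=
  Tsum ((polysOf X).image (cvsupp adj X)) (locv (cubeIn cube X ∘ γ)) (wv (actIn blk Δ ℱ adj χ p ek B Φ c Ys V cube Λ X t γ)) K

/-- **`D_X(t) := Σ_γ T[X-gas]_{γ,t}(L)`** — the assignment-summed truncated function of all `|L|` derivatives in the region `X` (the integrand of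
the head theorem's `ℛ_k` when `X = Λ₁₂`): notation. [cite: BalabanImbrieJaffe1988, (5.14.2) p.308; p.310] -/
abbrev DIn (X : Finset I) (L : Type*) [Fintype L] [DecidableEq L] (t : ℝ) : ℝ :=
  ∑ γ : L → ↥(slotB B Ys cube X) ⊕ ↥(slotY B Ys cube X), TIn blk Δ ℱ adj χ p ek B Φ c Ys V cube Λ X t γ univ

end Notation

section Agreement

variable {cube} {X W₀ : Finset I}

/-- **THE ACTIVITIES OF THE TWO LOCATED DATA AGREE ON THE POLYMERS OF `X`** (p. 306: *"⟨·⟩_{s_Γ,X} is defined by integrating over the fields in X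
only"*): `g1_congr` + `expect_congr` + `fD_inclSlot`. [cite: BalabanImbrieJaffe1988, (5.14.3) p.309; p.306] -/
theorem actIn_inclSlot (h : X ⊆ W₀) {L : Type*} [DecidableEq L] (γ : L → ↥(slotB B Ys cube X) ⊕ ↥(slotY B Ys cube X)) (t : ℝ)
    (H : Finset L) {Y : Finset I} (hY : Y ⊆ X) :
    actIn blk Δ ℱ adj χ p ek B Φ c Ys V cube Λ W₀ t (inclSlot h ∘ γ) H Y = actIn blk Δ ℱ adj χ p ek B Φ c Ys V cube Λ X t γ H Y := by
  have key : g1 adj (zG blk (interpForm blk Δ (corner ℝ Λ)) ℱ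
      (fD (uD χ p ek (slotB B Ys cube W₀) (fun b : ↥B => Φ b) (fun b : ↥B => c b) (slotY B Ys cube W₀) (fun Y : ↥Ys => V Y) t)
        (cubeIn cube W₀) (inclSlot h ∘ γ) H)) Y =
      g1 adj (zG blk (interpForm blk Δ (corner ℝ Λ)) ℱ
        (fD (uD χ p ek (slotB B Ys cube X) (fun b : ↥B => Φ b) (fun b : ↥B => c b) (slotY B Ys cube X) (fun Y : ↥Ys => V Y) t)
          (cubeIn cube X) γ H)) Y :=
    g1_congr adj fun Λ' _ => expect_congr blk _ ℱ (fun i hi => fD_inclSlot χ h γ t H (hY hi)) _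
  simp only [actIn, prime, g3]
  rw [key]

/-- **the truncated functions of the `X`-gas read through `incl` are those of the `X`-gas** (same localization, activities agreeing on the polymers
of `X`). [cite: BalabanImbrieJaffe1988, p.310 (Sect. 5.14)] -/
theorem Tsum_inclSlot (h : X ⊆ W₀) {L : Type*} [Fintype L] [DecidableEq L] (γ : L → ↥(slotB B Ys cube X) ⊕ ↥(slotY B Ys cube X))
    (t : ℝ) (K : Finset L) :
    Tsum ((polysOf X).image (cvsupp adj X)) (locv (cubeIn cube W₀ ∘ inclSlot h ∘ γ))
        (wv (actIn blk Δ ℱ adj χ p ek B Φ c Ys V cube Λ W₀ t (inclSlot h ∘ γ))) K =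
      TIn blk Δ ℱ adj χ p ek B Φ c Ys V cube Λ X t γ K := by
  have hloc : (cubeIn cube W₀ ∘ inclSlot h ∘ γ) = (cubeIn cube X ∘ γ) := funext fun l => cubeIn_inclSlot h (γ l)
  simp only [TIn]
  rw [hloc]
  exact Tsum_image_congr (polysOf X) (fun _ _ _ _ hh => vsupp_injective hh) (fun _ _ _ _ hh => vsupp_injective hh) (fun _ _ _ _ => Iff.rfl)
    (fun _ _ _ => Iff.rfl) (fun Y hY H => by rw [wv_vsupp, wv_vsupp]; exact actIn_inclSlot blk Δ ℱ adj χ Λ h γ t H (mem_polysOf.1 hY).1) K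

omit [Fintype I] in
/-- **THE ASSIGNMENTS OF `W₀` SUPPORTED IN `X` ARE THE ASSIGNMENTS OF `X`** (*"summing over {γ_j} with suppt(d/dt)_{γ_j} ⊂ X"*): re-indexing a
sum over the `γ : L → slots(W₀)` with all cubes in `X` by the `γ' : L → slots(X)`. [cite: BalabanImbrieJaffe1988, p.310 (Sect. 5.14)] -/
theorem sum_filter_supp_eq_sum_incl (h : X ⊆ W₀) {L : Type*} [Fintype L] [DecidableEq L]
    (F : (L → ↥(slotB B Ys cube W₀) ⊕ ↥(slotY B Ys cube W₀)) → ℝ) :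
    ∑ γ ∈ univ.filter (fun γ : L → ↥(slotB B Ys cube W₀) ⊕ ↥(slotY B Ys cube W₀) => ∀ l, cubeIn cube W₀ (γ l) ∈ X), F γ =
      ∑ γ' : L → ↥(slotB B Ys cube X) ⊕ ↥(slotY B Ys cube X), F (inclSlot h ∘ γ') := by
  have hinj : Function.Injective fun γ' : L → ↥(slotB B Ys cube X) ⊕ ↥(slotY B Ys cube X) => inclSlot h ∘ γ' :=
    fun γ₁ γ₂ hh => funext fun l => inclSlot_injective h (congrFun hh l)
  rw [← sum_image fun γ₁ _ γ₂ _ hh => hinj hh]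
  refine sum_congr ?_ fun _ _ => rfl
  ext γ
  rw [mem_filter, Finset.mem_image]
  simp only [mem_univ, true_and]
  constructor
  · intro hγ
    choose γ' hγ' using fun l => exists_inclSlot_eq h (γ l) (hγ l)
    exact ⟨γ', funext hγ'⟩
  · rintro ⟨γ', rfl⟩ l
    rw [Function.comp_apply, cubeIn_inclSlot]
    exact cubeIn_mem cube X (γ' l)

/-- **`Σ_{γ : supp ⊆ X} T[X-gas]_{γ}(W₀-data) = D_X`**: the assignment sum of the `X`-gas truncated functions over the assignments of `W₀` supported
in `X` is the assignment sum of the region `X` with its own located data. [cite: BalabanImbrieJaffe1988, p.310 (Sect. 5.14)] -/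
theorem sum_filter_supp_Tsum_eq_DIn (h : X ⊆ W₀) {L : Type*} [Fintype L] [DecidableEq L] (t : ℝ) :
    ∑ γ ∈ univ.filter (fun γ : L → ↥(slotB B Ys cube W₀) ⊕ ↥(slotY B Ys cube W₀) => ∀ l, cubeIn cube W₀ (γ l) ∈ X),
        Tsum ((polysOf X).image (cvsupp adj X)) (locv (cubeIn cube W₀ ∘ γ)) (wv (actIn blk Δ ℱ adj χ p ek B Φ c Ys V cube Λ W₀ t γ)) univ =
      DIn blk Δ ℱ adj χ p ek B Φ c Ys V cube Λ X L t := by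
  rw [sum_filter_supp_eq_sum_incl h]
  exact sum_congr rfl fun γ' _ => Tsum_inclSlot blk Δ ℱ adj χ Λ h γ' t univ

end Agreement

/-! ## §2 `W₆^{(k)′}(X)` as printed -/

section W6

variable (p ek B Φ c Ys V)

/-- **`W₆^{(k)′}(X)` AS PRINTED** (p. 310, the sentence after display 4: *"Here W₆^{(k)′}(X) is obtained by summing only over {X_γ}, (Y₁, …, Y_B)
which fill X, summing over {γ_j} with suppt(d/dt)_{γ_j} ⊂ X, and integrating over t as in (5.14.2)"*), for the cluster-configuration gas of the
region `W₀` (= `Λ^{(k)}_{12}`) at the corner `Λ` with `|L| = n̄+1` derivative labels: the `X`-PIECES `T^{fill X}_{γ,t}(L)`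
(`BIJ88ConnectedGraphFilling.TsumFill`: the terms of the display-3 series whose clusters `X_γ` and polymers `Y_δ` have union of cubes exactly `X`)
summed over the assignments `γ` of the slots of `W₀` with every cube in `X`, integrated against the (5.14.2) weight (r16's `remR`, weight
`(1−t)^{n̄}/(n̄+1)!`), times the factor `(n̄+1)` restoring the printed `1/n̄!` of (5.14.2) (slip G-C2-p36-06, exactly as in the head theorem's `ℛ_k`).
[cite: BalabanImbrieJaffe1988, p.310 display 4 and the sentence following it; (5.14.2) p.308] -/
def W6v (W₀ : Finset I) (L : Type) [Fintype L] [DecidableEq L] (nbar : ℕ) (X : Finset I) : ℝ :=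
  (nbar + 1 : ℝ) * remR (fun t => ∑ γ ∈ univ.filter (fun γ : L → ↥(slotB B Ys cube W₀) ⊕ ↥(slotY B Ys cube W₀) => ∀ l, cubeIn cube W₀ (γ l) ∈ X),
    TsumFill ((polysOf W₀).image (cvsupp adj W₀)) (locv (cubeIn cube W₀ ∘ γ)) (wv (actIn blk Δ ℱ adj χ p ek B Φ c Ys V cube Λ W₀ t γ))
      cubesOf X univ) nbar

/-- unfolding `W6v`. [cite: BalabanImbrieJaffe1988, p.310 (Sect. 5.14)] -/
theorem W6v_def (W₀ : Finset I) (L : Type) [Fintype L] [DecidableEq L] (nbar : ℕ) (X : Finset I) :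
    W6v blk Δ ℱ adj χ p ek B Φ c Ys V cube Λ W₀ L nbar X =
      (nbar + 1 : ℝ) * remR (fun t => ∑ γ ∈ univ.filter (fun γ : L → ↥(slotB B Ys cube W₀) ⊕ ↥(slotY B Ys cube W₀) =>
          ∀ l, cubeIn cube W₀ (γ l) ∈ X),
        TsumFill ((polysOf W₀).image (cvsupp adj W₀)) (locv (cubeIn cube W₀ ∘ γ)) (wv (actIn blk Δ ℱ adj χ p ek B Φ c Ys V cube Λ W₀ t γ))
          cubesOf X univ) nbar := rfl

end W6

/-! ## §3 The closed form: `W₆′` is the Möbius inverse of the sub-region remainders -/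

section Closed

variable {cube}

/-- **THE INTEGRAND OF `W₆′(X)` IS THE CORNER SUM OF THE SUB-REGION INTEGRANDS, MODULO (5.14.4)**: for `X ⊆ W₀`, `t` with the leaf (5.14.4) for the
data of `W₀`, `Σ_{γ : supp ⊆ X} T^{fill X}_{γ,t}(L) = Σ_{X' ⊆ X} (−1)^{|X∖X'|} D_{X'}(t)` — the `X`-piece is the corner sum of the sub-region truncated
functions (`BIJ88ConnectedGraphFillingVsupp.TsumFill_vsupp_eq_cornerSum_of_ineq5144`), corner sums commute with the assignment sum, an assignment
not supported in `X'` contributes nothing to the `X'`-gas, and the assignments supported in `X'` are those of `X'` with its own data (§1).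
[cite: BalabanImbrieJaffe1988, p.310 display 4 and the sentence following it; (5.14.4) p.309] -/
theorem integrand_eq_cornerSum {nbr : I → Finset I} {D : ℕ} {θ β' : ℝ} (hR : ∀ x y, adj x y → adj y x) (hD : ∀ x, (nbr x).card ≤ D)
    (hnbr : ∀ x y, adj x y → y ∈ nbr x) (hθ0 : 0 < θ) (hθ1 : θ ≤ 1) (hβ : 0 ≤ β') (hsmall : 16 * ((D : ℝ) + 1) ^ 2 * (θ ^ (β' / 2) * Real.exp 2) ≤ 1)
    {X W₀ : Finset I} (hXW : X ⊆ W₀) (L : Type) [Fintype L] [DecidableEq L] [Nonempty L] {t : ℝ}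
    (h5144 : ∀ γ : L → ↥(slotB B Ys cube W₀) ⊕ ↥(slotY B Ys cube W₀), Ineq5144 (cubeSys I) (Finset L)
      (actIn blk Δ ℱ adj χ p ek B Φ c Ys V cube Λ W₀ t γ) Finset.card (fun H (X'' : Finset I) => (X'' \ H.image (cubeIn cube W₀ ∘ γ)).card) θ β') :
    ∑ γ ∈ univ.filter (fun γ : L → ↥(slotB B Ys cube W₀) ⊕ ↥(slotY B Ys cube W₀) => ∀ l, cubeIn cube W₀ (γ l) ∈ X),
        TsumFill ((polysOf W₀).image (cvsupp adj W₀)) (locv (cubeIn cube W₀ ∘ γ)) (wv (actIn blk Δ ℱ adj χ p ek B Φ c Ys V cube Λ W₀ t γ))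
          cubesOf X univ =
      cornerSum (fun X' => DIn blk Δ ℱ adj χ p ek B Φ c Ys V cube Λ X' L t) X := by
  calc ∑ γ ∈ univ.filter (fun γ : L → ↥(slotB B Ys cube W₀) ⊕ ↥(slotY B Ys cube W₀) => ∀ l, cubeIn cube W₀ (γ l) ∈ X),
        TsumFill ((polysOf W₀).image (cvsupp adj W₀)) (locv (cubeIn cube W₀ ∘ γ)) (wv (actIn blk Δ ℱ adj χ p ek B Φ c Ys V cube Λ W₀ t γ))
          cubesOf X univ
      = ∑ γ ∈ univ.filter (fun γ : L → ↥(slotB B Ys cube W₀) ⊕ ↥(slotY B Ys cube W₀) => ∀ l, cubeIn cube W₀ (γ l) ∈ X),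
          cornerSum (fun X' => Tsum ((polysOf X').image (cvsupp adj X')) (locv (cubeIn cube W₀ ∘ γ))
            (wv (actIn blk Δ ℱ adj χ p ek B Φ c Ys V cube Λ W₀ t γ)) univ) X :=
        sum_congr rfl fun γ _ => TsumFill_vsupp_eq_cornerSum_of_ineq5144 hR hD hnbr hθ0 hθ1 hβ hsmall (h5144 γ) hXW univ_nonempty
    _ = cornerSum (fun X' => ∑ γ ∈ univ.filter (fun γ : L → ↥(slotB B Ys cube W₀) ⊕ ↥(slotY B Ys cube W₀) => ∀ l, cubeIn cube W₀ (γ l) ∈ X),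
          Tsum ((polysOf X').image (cvsupp adj X')) (locv (cubeIn cube W₀ ∘ γ)) (wv (actIn blk Δ ℱ adj χ p ek B Φ c Ys V cube Λ W₀ t γ)) univ) X :=
        (cornerSum_finset_sum _ _ X).symm
    _ = cornerSum (fun X' => DIn blk Δ ℱ adj χ p ek B Φ c Ys V cube Λ X' L t) X := cornerSum_congr fun X' hX' => by
        rw [← sum_filter_supp_Tsum_eq_DIn blk Δ ℱ adj χ Λ (hX'.trans hXW) t]
        refine (sum_subset (fun γ hγ => ?_) fun γ _ hγ => ?_).symm
        · simp only [mem_filter, mem_univ, true_and] at hγ ⊢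
          exact fun l => hX' (hγ l)
        · simp only [mem_filter, mem_univ, true_and, not_forall] at hγ
          obtain ⟨l, hl⟩ := hγ
          exact Tsum_vsupp_eq_zero_of_not_mem ⟨l, mem_univ _, hl⟩

/-- **`D_X(t) = (d/dt)^{|L|} log z_t(X)(Λ)` ON THE BRANCH `t ∈ (0,1]`, MODULO (5.14.4)** ((5.14.2) + displays 1–3 for the located data of the
region `X`: p36 g11's `BIJ88SlotConnectedGraph310KP.sum_Tsum_univ_eq_iteratedDeriv_log_zG_of_ineq5144` for the form `Δ_{1_Λ}` and p25's located
slots, `z(X)(Λ) = z_t` by p25's `ztIn_eq_zG_located`; a region without slots has `D_X = 0 = (log 1)^{(n)}`).  `χ ≥ 0`, `p ≥ 0`, `Δ ≻ 0`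
coupling abutting cubes only, continuous cube-local slot fields vanishing at `0`, `c_b ≥ c₀ > 0`, measurable bounded cube-local terms,
`0 < e_k < e^{−1}`. [cite: BalabanImbrieJaffe1988, (5.14.2) p.308; p.310 displays 1–3; (5.14.4) p.309] -/
theorem DIn_eq_iteratedDeriv_log_ztIn {nbr : I → Finset I} {D : ℕ} {θ β' : ℝ} (hR : ∀ x y, adj x y → adj y x)
    (hD : ∀ x, (nbr x).card ≤ D) (hnbr : ∀ x y, adj x y → y ∈ nbr x) (hθ0 : 0 < θ) (hθ1 : θ ≤ 1) (hβ : 0 ≤ β')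
    (hsmall : 16 * ((D : ℝ) + 1) ^ 2 * (θ ^ (β' / 2) * Real.exp 2) ≤ 1) (hχ : ∀ x, 0 ≤ χ.χ₁ x) (hp : 0 ≤ p)
    (hΔadj : ∀ x y, blk x ≠ blk y → ¬ adj (blk x) (blk y) → Δ x y = 0) (hΔ : Δ.PosDef)
    (hΦloc : ∀ b : B, ∀ φ ψ : α → ℝ, (∀ x, blk x = cube (Sum.inl b) → φ x = ψ x) → Φ b φ = Φ b ψ)
    (hVloc : ∀ Y : Ys, ∀ φ ψ : α → ℝ, (∀ x, blk x = cube (Sum.inr Y) → φ x = ψ x) → V Y φ = V Y ψ)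
    (hΦc : ∀ b ∈ B, Continuous (Φ b)) (hΦ0 : ∀ b ∈ B, Φ b 0 = 0) {c₀ : ℝ} (hc₀ : 0 < c₀) (hcb : ∀ b ∈ B, c₀ ≤ c b)
    (hV : ∀ Y ∈ Ys, Measurable (V Y)) {KY : υ → ℝ} (hK : ∀ Y ∈ Ys, ∀ φ, |V Y φ| ≤ KY Y) (hek : 0 < ek) (hek1 : ek < Real.exp (-1))
    (X : Finset I) (L : Type) [Fintype L] [DecidableEq L] [Nonempty L] {t : ℝ} (ht : t ∈ Set.Ioc (0 : ℝ) 1)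
    (h5144 : ∀ γ : L → ↥(slotB B Ys cube X) ⊕ ↥(slotY B Ys cube X), Ineq5144 (cubeSys I) (Finset L)
      (actIn blk Δ ℱ adj χ p ek B Φ c Ys V cube Λ X t γ) Finset.card (fun H (X'' : Finset I) => (X'' \ H.image (cubeIn cube X ∘ γ)).card) θ β') :
    DIn blk Δ ℱ adj χ p ek B Φ c Ys V cube Λ X L t =
      iteratedDeriv (Fintype.card L) (fun x => Real.log (ztIn blk Δ ℱ χ p ek B Φ c Ys V cube X Λ x)) t := by
  rcases isEmpty_or_nonempty (↥(slotB B Ys cube X) ⊕ ↥(slotY B Ys cube X)) with hE | ⟨⟨τ₀⟩⟩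
  · -- no slot located in `X`: both sides vanish
    have hB0 : slotB B Ys cube X = ∅ := Finset.isEmpty_coe_sort.1 (isEmpty_sum.1 hE).1
    have hY0 : slotY B Ys cube X = ∅ := Finset.isEmpty_coe_sort.1 (isEmpty_sum.1 hE).2
    haveI := isProbabilityMeasure_regionLaw blk Δ ℱ hΔ X Λ
    have hz : (fun x => Real.log (ztIn blk Δ ℱ χ p ek B Φ c Ys V cube X Λ x)) = fun _ => 0 := by
      funext x
      simp only [ztIn, zt_eq, hB0, hY0, prod_empty, sum_empty, mul_zero, neg_zero, Real.exp_zero, mul_one, integral_const,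
        probReal_univ, smul_eq_mul, Real.log_one]
    have hn : Fintype.card L ≠ 0 := Fintype.card_ne_zero
    rw [hz, iteratedDeriv_const, if_neg hn]
    exact Fintype.sum_empty _
  · have hsub : Set.Ioc (0 : ℝ) 1 ⊆ Set.Ioo 0 (Real.exp (-1) / ek) := fun x hx =>
      ⟨hx.1, hx.2.trans_lt ((one_lt_div hek).2 hek1)⟩
    have h := sum_Tsum_univ_eq_iteratedDeriv_log_zG_of_ineq5144 blk (interpForm blk Δ (corner ℝ Λ)) ℱ X adj χ
      (B := slotB B Ys cube X) (Φ := fun b : ↥B => Φ b) (c := fun b : ↥B => c b) (Ys := slotY B Ys cube X) (V := fun Y : ↥Ys => V Y)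
      (cubeIn cube X) hR hD hnbr hθ0 hθ1 hβ hsmall hχ hp (interpForm_abutting blk Δ adj hΔadj Λ) (prec_interp_corner_posDef blk Δ hΔ X Λ)
      (cubeIn_mem cube X) (fun b φ ψ hh => hΦloc b.1 φ ψ hh) (fun Y φ ψ hh => hVloc Y.1 φ ψ hh) (fun b _ => hΦc b b.2)
      (fun b _ => hΦ0 b b.2) hc₀ (fun b _ => hcb b b.2) (fun Y _ => hV Y Y.2) (KY := fun Y => KY Y) (fun Y _ φ => hK Y Y.2 φ) hek
      (uniqueDiffOn_Ioc 0 1) hsub (fun _ => τ₀) ht h5144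
    have hbr : (fun x => Real.log (ztIn blk Δ ℱ χ p ek B Φ c Ys V cube X Λ x)) = fun x => Real.log
        (zG blk (interpForm blk Δ (corner ℝ Λ)) ℱ (fD (uD χ p ek (slotB B Ys cube X) (fun b : ↥B => Φ b) (fun b : ↥B => c b)
          (slotY B Ys cube X) (fun Y : ↥Ys => V Y) x) (cubeIn cube X) (fun _ : L => τ₀) ∅) X X) :=
      funext fun x => by rw [ztIn_eq_zG_located blk Δ ℱ χ cube X Λ (fun _ : L => τ₀) x]
    rw [hbr]
    exact h

/-- **`z_t(X)(Λ) > 0` on `(0,1]`** (p25's `zG_fD_empty_pos` read through `zG_fD_empty_eq_ztIn`). [cite: BalabanImbrieJaffe1988, (5.14.2) p.308] -/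
theorem ztIn_pos_of_Ioc (hχ : ∀ x, 0 ≤ χ.χ₁ x) (hp : 0 ≤ p) (hΔ : Δ.PosDef) (hΦc : ∀ b ∈ B, Continuous (Φ b)) (hΦ0 : ∀ b ∈ B, Φ b 0 = 0)
    {c₀ : ℝ} (hc₀ : 0 < c₀) (hcb : ∀ b ∈ B, c₀ ≤ c b) (hV : ∀ Y ∈ Ys, Measurable (V Y)) {KY : υ → ℝ} (hK : ∀ Y ∈ Ys, ∀ φ, |V Y φ| ≤ KY Y)
    (hek : 0 < ek) (hek1 : ek < Real.exp (-1)) (X : Finset I) {t : ℝ} (ht : t ∈ Set.Ioc (0 : ℝ) 1) :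
    0 < ztIn blk Δ ℱ χ p ek B Φ c Ys V cube X Λ t := by
  rw [← zG_fD_empty_eq_ztIn blk Δ ℱ χ (p := p) (ek := ek) (B := B) (Φ := Φ) (c := c) (Ys := Ys) (V := V) cube
    (fun e : Empty => (e.elim : ↥B ⊕ ↥Ys)) t]
  exact zG_fD_empty_pos blk Δ ℱ χ p ek B Φ c Ys V cube _ hχ hp hΔ hΦc hΦ0 hc₀ hcb hV hK hek ht.1
    (BIJ88ZtPositivity308.mul_le_exp_neg_one_of_Ioc hek hek1.le ht) _ _

/-- **THE (5.14.2) REMAINDER DENSITY OF EVERY REGION IS INTEGRABLE ON `[0,1]`, MODULO (5.14.4)** — *"integrating over t as in (5.14.2)"* is a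
genuine integral: `t ↦ −((1−t)^{n̄}/(n̄+1)!)·D_X(t)` is interval-integrable on `[0,1]` (on `(0,1]` it is `−(1/(n̄+1))` times the density
`((1−t)^{n̄}/n̄!)(d/dt)^{n̄+1} log z_t(X)` of p36 g12's `BIJ88EffectiveActionL1Remainder308.integrableOn_remainderDensity_of_L1`, whose `L¹` input is
p36 g13's `BIJ88Eq5145CornerModulus.slotFields_L1_mod_regionLaw` — linear-or-modulus slot fields, p. 309 — and whose `z_t ≠ 0` is `ztIn_pos_of_Ioc`).
[cite: BalabanImbrieJaffe1988, (5.14.2) p.308; p.309; (5.14.4) p.309] -/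
theorem intervalIntegrable_weight_DIn {nbr : I → Finset I} {D : ℕ} {θ β' : ℝ} (hR : ∀ x y, adj x y → adj y x)
    (hD : ∀ x, (nbr x).card ≤ D) (hnbr : ∀ x y, adj x y → y ∈ nbr x) (hθ0 : 0 < θ) (hθ1 : θ ≤ 1) (hβ : 0 ≤ β')
    (hsmall : 16 * ((D : ℝ) + 1) ^ 2 * (θ ^ (β' / 2) * Real.exp 2) ≤ 1) (hχ : ∀ x, 0 ≤ χ.χ₁ x) (hp : 1 / 2 < p)
    (hΔadj : ∀ x y, blk x ≠ blk y → ¬ adj (blk x) (blk y) → Δ x y = 0) (hΔ : Δ.PosDef)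
    (hΦloc : ∀ b : B, ∀ φ ψ : α → ℝ, (∀ x, blk x = cube (Sum.inl b) → φ x = ψ x) → Φ b φ = Φ b ψ)
    (hVloc : ∀ Y : Ys, ∀ φ ψ : α → ℝ, (∀ x, blk x = cube (Sum.inr Y) → φ x = ψ x) → V Y φ = V Y ψ)
    (hmod : ∀ b ∈ B, ∃ ℓ₁ ℓ₂ : (α → ℝ) → ℝ, IsLinearMap ℝ ℓ₁ ∧ IsLinearMap ℝ ℓ₂ ∧
      ((∀ φ, Φ b φ = ℓ₁ φ) ∨ (∀ φ, Φ b φ = Real.sqrt (ℓ₁ φ ^ 2 + ℓ₂ φ ^ 2))))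
    {c₀ : ℝ} (hc₀ : 0 < c₀) (hcb : ∀ b ∈ B, c₀ ≤ c b) (hV : ∀ Y ∈ Ys, Measurable (V Y)) {KY : υ → ℝ} (hK : ∀ Y ∈ Ys, ∀ φ, |V Y φ| ≤ KY Y)
    (hek : 0 < ek) (hek1 : ek < Real.exp (-1)) (X : Finset I) (L : Type) [Fintype L] [DecidableEq L] {nbar : ℕ}
    (hL : Fintype.card L = nbar + 1)
    (h5144 : ∀ t ∈ Set.Ioc (0 : ℝ) 1, ∀ γ : L → ↥(slotB B Ys cube X) ⊕ ↥(slotY B Ys cube X), Ineq5144 (cubeSys I) (Finset L)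
      (actIn blk Δ ℱ adj χ p ek B Φ c Ys V cube Λ X t γ) Finset.card (fun H (X'' : Finset I) => (X'' \ H.image (cubeIn cube X ∘ γ)).card) θ β') :
    IntervalIntegrable (fun t => -((1 - t) ^ nbar / ((nbar + 1).factorial : ℝ)) * DIn blk Δ ℱ adj χ p ek B Φ c Ys V cube Λ X L t)
      volume 0 1 := by
  haveI : Nonempty L := Fintype.card_pos_iff.1 (by omega)
  have hcz : ∀ b ∈ B, Continuous (Φ b) ∧ Φ b 0 = 0 := fun b hb => by
    obtain ⟨ℓ₁, ℓ₂, h₁, h₂, h⟩ := hmod b hb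
    exact continuous_and_zero_of_mod h₁ h₂ h
  haveI := isProbabilityMeasure_regionLaw blk Δ ℱ hΔ X Λ
  have hΦ' : ∀ b ∈ slotB B Ys cube X, Measurable fun ω : {x : α // blk x ∈ X} → ℝ => Φ b (ext blk X ω) :=
    fun b _ => ((hcz b b.2).1.comp (continuous_ext blk X)).measurable
  have hV' : Measurable fun ω : {x : α // blk x ∈ X} → ℝ => ∑ Y ∈ slotY B Ys cube X, V Y (ext blk X ω) :=
    Finset.measurable_sum _ fun Y _ => (hV Y Y.2).comp (measurable_ext blk X)
  have hK' : ∀ ω : {x : α // blk x ∈ X} → ℝ, |∑ Y ∈ slotY B Ys cube X, V Y (ext blk X ω)| ≤ ∑ Y ∈ slotY B Ys cube X, KY Y :=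
    fun ω => (abs_sum_le_sum_abs _ _).trans (sum_le_sum fun Y _ => hK Y Y.2 _)
  have hz : ∀ t ∈ Set.Ioc (0 : ℝ) 1, (∫ ω, (∏ b ∈ slotB B Ys cube X, cutoff χ (c b * pLog p (t * ek)) (Φ b (ext blk X ω))) *
      Real.exp (-(t * ∑ Y ∈ slotY B Ys cube X, V Y (ext blk X ω))) ∂(regionLaw blk Δ ℱ X Λ)) ≠ 0 := fun t ht => by
    have h := ztIn_pos_of_Ioc blk Δ ℱ χ (p := p) (cube := cube) Λ hχ (by linarith) hΔ (fun b hb => (hcz b hb).1)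
      (fun b hb => (hcz b hb).2) hc₀ hcb hV hK hek hek1 X ht
    simp only [ztIn, zt_eq] at h
    exact h.ne'
  have hg : IntegrableOn (fun t => ((1 - t) ^ nbar / (nbar.factorial : ℝ)) *
      iteratedDeriv (nbar + 1) (fun t => Real.log (ztIn blk Δ ℱ χ p ek B Φ c Ys V cube X Λ t)) t) (Set.uIcc (0 : ℝ) 1) := by
    have h := integrableOn_remainderDensity_of_L1 χ (by linarith : 0 < p) (regionLaw blk Δ ℱ X Λ) (slotB B Ys cube X)
      (Φ := fun b ω => Φ b (ext blk X ω)) hΦ' (c := fun b : ↥B => c b) hc₀ (fun b _ => hcb b b.2) hV' hK' hek hek1 hz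
      (slotFields_L1_mod_regionLaw blk Δ ℱ χ (Ys := Ys) cube hΔ hp hmod hc₀ hcb hek X Λ) nbar
    simp only [ztIn, zt_eq]
    exact h
  rw [intervalIntegrable_iff, Set.uIoc_of_le zero_le_one]
  have hg' : IntegrableOn (fun t => (-(1 / (nbar + 1 : ℝ))) * (((1 - t) ^ nbar / (nbar.factorial : ℝ)) *
      iteratedDeriv (nbar + 1) (fun t => Real.log (ztIn blk Δ ℱ χ p ek B Φ c Ys V cube X Λ t)) t)) (Set.Ioc (0 : ℝ) 1) :=
    (hg.mono_set (by rw [Set.uIcc_of_le zero_le_one]; exact Set.Ioc_subset_Icc_self)).const_mul _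
  refine hg'.congr_fun (fun t ht => ?_) measurableSet_Ioc
  rw [DIn_eq_iteratedDeriv_log_ztIn blk Δ ℱ adj χ Λ hR hD hnbr hθ0 hθ1 hβ hsmall hχ (by linarith) hΔadj hΔ hΦloc hVloc
    (fun b hb => (hcz b hb).1) (fun b hb => (hcz b hb).2) hc₀ hcb hV hK hek hek1 X L ht (h5144 t ht), hL]
  have hf0 : (nbar.factorial : ℝ) ≠ 0 := by positivity
  push_cast [Nat.factorial_succ]
  field_simp

/-- **remainders are linear over finite combinations of interval-integrable truncated functions** (linearity of `∫₀¹`).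
[cite: BalabanImbrieJaffe1988, (5.14.2) p.308] -/
theorem remR_finset_sum {κ : Type*} (s : Finset κ) (a : κ → ℝ) (f : κ → ℝ → ℝ) (nbar : ℕ)
    (hf : ∀ b ∈ s, IntervalIntegrable (fun t => -((1 - t) ^ nbar / ((nbar + 1).factorial : ℝ)) * f b t) volume 0 1) :
    remR (fun t => ∑ b ∈ s, a b * f b t) nbar = ∑ b ∈ s, a b * remR (f b) nbar := by
  unfold remR
  have h : ∀ t : ℝ, -((1 - t) ^ nbar / ((nbar + 1).factorial : ℝ)) * ∑ b ∈ s, a b * f b t =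
      ∑ b ∈ s, a b * (-((1 - t) ^ nbar / ((nbar + 1).factorial : ℝ)) * f b t) := fun t => by
    rw [mul_sum]
    exact sum_congr rfl fun b _ => by ring
  simp_rw [h]
  rw [intervalIntegral.integral_finsetSum fun b hb => (hf b hb).const_mul (a b)]
  exact sum_congr rfl fun b _ => intervalIntegral.integral_const_mul _ _

/-- **`W₆^{(k)′}(X) = Σ_{X' ⊆ X} (−1)^{|X∖X'|} ℛ(X')` — `W₆′` IS THE MÖBIUS INVERSE, IN THE REGION, OF THE SUB-REGION REMAINDERS
`ℛ(X') := (n̄+1)·remR(D_{X'})`, MODULO (5.14.4)** (for `X ⊆ W₀`, `|L| = n̄+1`; the leaf for the located data of every sub-region of `W₀` at every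
`t ∈ (0,1]`; the hypotheses of `intervalIntegrable_weight_DIn`): `integrand_eq_cornerSum` on `(0,1]` (`remR_congr_Ioc`) and the linearity
`remR_finset_sum`. [cite: BalabanImbrieJaffe1988, p.310 display 4 and the sentence following it; (5.14.2) p.308; (5.14.4) p.309] -/
theorem W6v_eq_cornerSum {nbr : I → Finset I} {D : ℕ} {θ β' : ℝ} (hR : ∀ x y, adj x y → adj y x)
    (hD : ∀ x, (nbr x).card ≤ D) (hnbr : ∀ x y, adj x y → y ∈ nbr x) (hθ0 : 0 < θ) (hθ1 : θ ≤ 1) (hβ : 0 ≤ β')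
    (hsmall : 16 * ((D : ℝ) + 1) ^ 2 * (θ ^ (β' / 2) * Real.exp 2) ≤ 1) (hχ : ∀ x, 0 ≤ χ.χ₁ x) (hp : 1 / 2 < p)
    (hΔadj : ∀ x y, blk x ≠ blk y → ¬ adj (blk x) (blk y) → Δ x y = 0) (hΔ : Δ.PosDef)
    (hΦloc : ∀ b : B, ∀ φ ψ : α → ℝ, (∀ x, blk x = cube (Sum.inl b) → φ x = ψ x) → Φ b φ = Φ b ψ)
    (hVloc : ∀ Y : Ys, ∀ φ ψ : α → ℝ, (∀ x, blk x = cube (Sum.inr Y) → φ x = ψ x) → V Y φ = V Y ψ)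
    (hmod : ∀ b ∈ B, ∃ ℓ₁ ℓ₂ : (α → ℝ) → ℝ, IsLinearMap ℝ ℓ₁ ∧ IsLinearMap ℝ ℓ₂ ∧
      ((∀ φ, Φ b φ = ℓ₁ φ) ∨ (∀ φ, Φ b φ = Real.sqrt (ℓ₁ φ ^ 2 + ℓ₂ φ ^ 2))))
    {c₀ : ℝ} (hc₀ : 0 < c₀) (hcb : ∀ b ∈ B, c₀ ≤ c b) (hV : ∀ Y ∈ Ys, Measurable (V Y)) {KY : υ → ℝ} (hK : ∀ Y ∈ Ys, ∀ φ, |V Y φ| ≤ KY Y)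
    (hek : 0 < ek) (hek1 : ek < Real.exp (-1)) {X W₀ : Finset I} (hXW : X ⊆ W₀) (L : Type) [Fintype L] [DecidableEq L] {nbar : ℕ}
    (hL : Fintype.card L = nbar + 1)
    (h5144 : ∀ X' ⊆ W₀, ∀ t ∈ Set.Ioc (0 : ℝ) 1, ∀ γ : L → ↥(slotB B Ys cube X') ⊕ ↥(slotY B Ys cube X'), Ineq5144 (cubeSys I) (Finset L)
      (actIn blk Δ ℱ adj χ p ek B Φ c Ys V cube Λ X' t γ) Finset.card (fun H (X'' : Finset I) => (X'' \ H.image (cubeIn cube X' ∘ γ)).card) θ β') :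
    W6v blk Δ ℱ adj χ p ek B Φ c Ys V cube Λ W₀ L nbar X =
      cornerSum (fun X' => (nbar + 1 : ℝ) * remR (DIn blk Δ ℱ adj χ p ek B Φ c Ys V cube Λ X' L) nbar) X := by
  haveI : Nonempty L := Fintype.card_pos_iff.1 (by omega)
  rw [W6v_def, remR_congr_Ioc (fun t ht => integrand_eq_cornerSum blk Δ ℱ adj χ Λ hR hD hnbr hθ0 hθ1 hβ hsmall hXW L
    (h5144 W₀ Subset.rfl t ht)) nbar]
  simp only [cornerSum]
  rw [remR_finset_sum X.powerset (fun X' => (-1 : ℝ) ^ (X \ X').card) (fun X' => DIn blk Δ ℱ adj χ p ek B Φ c Ys V cube Λ X' L) nbar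
    fun X' hX' => intervalIntegrable_weight_DIn blk Δ ℱ adj χ Λ hR hD hnbr hθ0 hθ1 hβ hsmall hχ hp hΔadj hΔ hΦloc hVloc hmod hc₀ hcb hV hK
      hek hek1 X' L hL (h5144 X' ((mem_powerset.1 hX').trans hXW)), mul_sum]
  exact sum_congr rfl fun X' _ => by ring

end Closed

/-! ## §4 Display 4: `ℛ_k(Λ₁₂) = Σ_{X ⊂ Λ₁₂} W₆′(X)` derived -/

section Display4

variable {cube}

/-- **DISPLAY 4 OF p. 310 DERIVED, MODULO (5.14.4): `Σ_{X ⊆ W₀} W₆^{(k)′}(X) = ℛ(W₀) = (n̄+1)·remR(t ↦ Σ_γ T[W₀-gas]_{γ,t}(L))`** — the sum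
over the regions `X ⊆ W₀` of the printed `W₆′(X)` IS the exponent term `ℛ_k(Λ₁₂)` of the (5.14.5) head theorem
(`BIJ88Eq5145CornerModulus.eq5145_zG_mod_remR_of_ineq5144`, with `W₀ = Λ₁₂ = lam12 W ρ`, `Λ = Λ₁₂′ = lam12' adj W ρ`), which read display 4 as
the DEFINITION of the `W₆′`-sum: Möbius inversion (`BIJ88Clusters5134.sum_powerset_cornerSum`) of `W6v_eq_cornerSum`.  Hypotheses: those of
`W6v_eq_cornerSum` (the leaf (5.14.4) for the located data of every sub-region of `W₀` at every `t ∈ (0,1]`, in gen 5's regime).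
[cite: BalabanImbrieJaffe1988, p.310 display 4; (5.14.2) p.308; (5.14.4) p.309; (5.14.5) p.312] -/
theorem display4 {nbr : I → Finset I} {D : ℕ} {θ β' : ℝ} (hR : ∀ x y, adj x y → adj y x)
    (hD : ∀ x, (nbr x).card ≤ D) (hnbr : ∀ x y, adj x y → y ∈ nbr x) (hθ0 : 0 < θ) (hθ1 : θ ≤ 1) (hβ : 0 ≤ β')
    (hsmall : 16 * ((D : ℝ) + 1) ^ 2 * (θ ^ (β' / 2) * Real.exp 2) ≤ 1) (hχ : ∀ x, 0 ≤ χ.χ₁ x) (hp : 1 / 2 < p)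
    (hΔadj : ∀ x y, blk x ≠ blk y → ¬ adj (blk x) (blk y) → Δ x y = 0) (hΔ : Δ.PosDef)
    (hΦloc : ∀ b : B, ∀ φ ψ : α → ℝ, (∀ x, blk x = cube (Sum.inl b) → φ x = ψ x) → Φ b φ = Φ b ψ)
    (hVloc : ∀ Y : Ys, ∀ φ ψ : α → ℝ, (∀ x, blk x = cube (Sum.inr Y) → φ x = ψ x) → V Y φ = V Y ψ)
    (hmod : ∀ b ∈ B, ∃ ℓ₁ ℓ₂ : (α → ℝ) → ℝ, IsLinearMap ℝ ℓ₁ ∧ IsLinearMap ℝ ℓ₂ ∧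
      ((∀ φ, Φ b φ = ℓ₁ φ) ∨ (∀ φ, Φ b φ = Real.sqrt (ℓ₁ φ ^ 2 + ℓ₂ φ ^ 2))))
    {c₀ : ℝ} (hc₀ : 0 < c₀) (hcb : ∀ b ∈ B, c₀ ≤ c b) (hV : ∀ Y ∈ Ys, Measurable (V Y)) {KY : υ → ℝ} (hK : ∀ Y ∈ Ys, ∀ φ, |V Y φ| ≤ KY Y)
    (hek : 0 < ek) (hek1 : ek < Real.exp (-1)) (W₀ : Finset I) (L : Type) [Fintype L] [DecidableEq L] {nbar : ℕ}
    (hL : Fintype.card L = nbar + 1)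
    (h5144 : ∀ X' ⊆ W₀, ∀ t ∈ Set.Ioc (0 : ℝ) 1, ∀ γ : L → ↥(slotB B Ys cube X') ⊕ ↥(slotY B Ys cube X'), Ineq5144 (cubeSys I) (Finset L)
      (actIn blk Δ ℱ adj χ p ek B Φ c Ys V cube Λ X' t γ) Finset.card (fun H (X'' : Finset I) => (X'' \ H.image (cubeIn cube X' ∘ γ)).card) θ β') :
    ∑ X ∈ W₀.powerset, W6v blk Δ ℱ adj χ p ek B Φ c Ys V cube Λ W₀ L nbar X =
      (nbar + 1 : ℝ) * remR (DIn blk Δ ℱ adj χ p ek B Φ c Ys V cube Λ W₀ L) nbar := by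
  rw [← sum_powerset_cornerSum (fun X' => (nbar + 1 : ℝ) * remR (DIn blk Δ ℱ adj χ p ek B Φ c Ys V cube Λ X' L) nbar) W₀]
  exact sum_congr rfl fun X hX => W6v_eq_cornerSum blk Δ ℱ adj χ Λ hR hD hnbr hθ0 hθ1 hβ hsmall hχ hp hΔadj hΔ hΦloc hVloc hmod hc₀ hcb hV
    hK hek hek1 (mem_powerset.1 hX) L hL h5144

/-- **DISPLAY 4 IN THE LITERAL SHAPE OF THE HEAD THEOREM'S `hrem`** (`(n̄+1)·remR(t ↦ Σ_{γ'} Tsum[W₀-gas]_{γ',t}(univ)) = Σ_{X ⊆ W₀} W₆′(X)`):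
the exponent term of `BIJ88Eq5145CornerModulus.eq5145_zG_mod_remR_of_ineq5144` / the hypothesis `hrem` of `…_Tsum_of_ineq5144` with
`𝒳 := W₀.powerset`, `W6p := W6v`. [cite: BalabanImbrieJaffe1988, p.310 display 4; (5.14.5) p.312] -/
theorem remR_sum_Tsum_eq_sum_W6v {nbr : I → Finset I} {D : ℕ} {θ β' : ℝ} (hR : ∀ x y, adj x y → adj y x)
    (hD : ∀ x, (nbr x).card ≤ D) (hnbr : ∀ x y, adj x y → y ∈ nbr x) (hθ0 : 0 < θ) (hθ1 : θ ≤ 1) (hβ : 0 ≤ β')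
    (hsmall : 16 * ((D : ℝ) + 1) ^ 2 * (θ ^ (β' / 2) * Real.exp 2) ≤ 1) (hχ : ∀ x, 0 ≤ χ.χ₁ x) (hp : 1 / 2 < p)
    (hΔadj : ∀ x y, blk x ≠ blk y → ¬ adj (blk x) (blk y) → Δ x y = 0) (hΔ : Δ.PosDef)
    (hΦloc : ∀ b : B, ∀ φ ψ : α → ℝ, (∀ x, blk x = cube (Sum.inl b) → φ x = ψ x) → Φ b φ = Φ b ψ)
    (hVloc : ∀ Y : Ys, ∀ φ ψ : α → ℝ, (∀ x, blk x = cube (Sum.inr Y) → φ x = ψ x) → V Y φ = V Y ψ)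
    (hmod : ∀ b ∈ B, ∃ ℓ₁ ℓ₂ : (α → ℝ) → ℝ, IsLinearMap ℝ ℓ₁ ∧ IsLinearMap ℝ ℓ₂ ∧
      ((∀ φ, Φ b φ = ℓ₁ φ) ∨ (∀ φ, Φ b φ = Real.sqrt (ℓ₁ φ ^ 2 + ℓ₂ φ ^ 2))))
    {c₀ : ℝ} (hc₀ : 0 < c₀) (hcb : ∀ b ∈ B, c₀ ≤ c b) (hV : ∀ Y ∈ Ys, Measurable (V Y)) {KY : υ → ℝ} (hK : ∀ Y ∈ Ys, ∀ φ, |V Y φ| ≤ KY Y)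
    (hek : 0 < ek) (hek1 : ek < Real.exp (-1)) (W₀ : Finset I) (L : Type) [Fintype L] [DecidableEq L] {nbar : ℕ}
    (hL : Fintype.card L = nbar + 1)
    (h5144 : ∀ X' ⊆ W₀, ∀ t ∈ Set.Ioc (0 : ℝ) 1, ∀ γ : L → ↥(slotB B Ys cube X') ⊕ ↥(slotY B Ys cube X'), Ineq5144 (cubeSys I) (Finset L)
      (actIn blk Δ ℱ adj χ p ek B Φ c Ys V cube Λ X' t γ) Finset.card (fun H (X'' : Finset I) => (X'' \ H.image (cubeIn cube X' ∘ γ)).card) θ β') :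
    (nbar + 1 : ℝ) * remR (fun t => ∑ γ' : L → ↥(slotB B Ys cube W₀) ⊕ ↥(slotY B Ys cube W₀),
        Tsum ((polysOf W₀).image (cvsupp adj W₀)) (locv (cubeIn cube W₀ ∘ γ'))
          (wv (prime (g3 adj fun H' => zG blk (interpForm blk Δ (corner ℝ Λ)) ℱ
            (fD (uD χ p ek (slotB B Ys cube W₀) (fun b : ↥B => Φ b) (fun b : ↥B => c b) (slotY B Ys cube W₀) (fun Y : ↥Ys => V Y) t)
              (cubeIn cube W₀) γ' H')))) univ) nbar =
      ∑ X ∈ W₀.powerset, W6v blk Δ ℱ adj χ p ek B Φ c Ys V cube Λ W₀ L nbar X :=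
  (display4 blk Δ ℱ adj χ Λ hR hD hnbr hθ0 hθ1 hβ hsmall hχ hp hΔadj hΔ hΦloc hVloc hmod hc₀ hcb hV hK hek hek1 W₀ L hL h5144).symm

end Display4

end Literature.MathematicalPhysics.QuantumFieldTheory.BalabanImbrieJaffe1984to88.BIJ88W6PrimeVsupp

end
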